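import Literature.Probability.LatticeModels.FreeStateGibbs
import Literature.Probability.LatticeModels.PlusStateFKG
import HarnessLib

/-!
# The minus and plus infinite-volume Ising states are translation-invariant Gibbs measures
(discharge of `exists_minusMeasure` and `exists_plusMeasure`)

Topic `Literature/Probability/LatticeModels`; sibling proof file of `GibbsStates.lean`
(crit-ising.S05), companion of `FreeStateGibbs.lean` (the free state). For the nearest-neighbour Ising model on `ℤ^d`, `β ≥ 0` and **every** `h ∈ ℝ`,
the minus state `⟨·⟩⁻_{β,h}` and the plus state `⟨·⟩⁺_{β,h}` (thermodynamic limits along the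
centred boxes `B(L)` of the finite-volume Gibbs distributions with `−`, resp. `+`, boundary
condition) are probability measures on `{−1,+1}^{ℤ^d}` satisfying the DLR equations for the Ising
specification, translation invariant, with correlations `minusCorr d β h`, resp. `plusCorr d β h`
(Friedli–Velenik 2017, Thm. 3.17: existence along any `Λ_n ↑ ℤ^d` and translation invariance of
`⟨·⟩^±_{β,h}` for `β ≥ 0`, `h ∈ ℝ`; Thm. 6.26 with Lemma 6.7: limits of `π_{B(n)}(· | ω)` lie in
`𝒢(β,h)`; Example 6.51: `μ^±_{β,h}` are translation invariant).

## Contents and proof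

The architecture is that of the free state (`FreeStateLimit`, `FreeStateGibbs`:
`exists_freeMeasure_holds`), made uniform in a fixed boundary condition `η`:

* `tendsto_isingCorr_plus_box` — for `β ≥ 0` and every `h`, `⟨σ_A⟩⁺_{B(L);β,h} → plusCorr d β h A`:
  `σ_A = ∑_{B ⊆ A} c_B n_B` (`spinProduct_eq_sum_plusIndicator`, Friedli–Velenik Lemma 3.19) and
  the plus expectations of the increasing indicators `n_B` are nonincreasing in the volume by FKG
  (`tendsto_isingExpect_plus_plusIndicator` of `PlusStateFKG`, Friedli–Velenik Lemma 3.22 and the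
  proof of Thm. 3.17), FKG being the tree theorem `ising_fkg_holds`.
* `isingCorr_minus_eq_flip`, `minusCorr_eq_plusCorr_neg`, `tendsto_isingCorr_minus_box` — the
  minus state is the spin flip of the plus state at the opposite field:
  `⟨σ_A⟩⁻_{Λ;β,h} = (-1)^{|A|} ⟨σ_A⟩⁺_{Λ;β,-h}` (`isingCorr_fixed_flip_holds`, Friedli–Velenik
  §3.7.1), hence `⟨σ_A⟩⁻_{B(L);β,h} → minusCorr d β h A = (-1)^{|A|} plusCorr d β (-h) A`.
* `tendsto_isingExpect_box_of_dependsOn` — local observables are finite linear combinations of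
  spin products (`exists_sum_spinProduct_of_dependsOn`, Lemma 3.19), so their box expectations
  converge as soon as all correlations do.
* `exists_measure_tendsto_integral_of_dependsOn` — **the limit measure** of a sequence of
  probability measures on `{±1}^{ℤ^d}` whose local expectations converge (Friedli–Velenik Thm. 6.5
  / Def. 6.4, Riesz–Kolmogorov): through `spinConfigEquivSet` the images converge on the local
  events of `Set (Site d)`, Kolmogorov's extension theorem
  (`Percolation.exists_measure_tendsto_of_isLocalEvent`) gives the limit, and local expectations
  are sums over the spin patterns of a window (`dependsOn_eq_sum_mul_indicator`).
* `isGibbsMeasure_of_tendsto_isingExpect_fixed_box` — **limits of boxes with a fixed boundary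
  condition are Gibbs** (Friedli–Velenik Thm. 6.26, eq. (6.34)): for a local event `A`,
  `η' ↦ μ^{η'}_Λ(A)` is a local observable (`dependsOn_isingMeasure_fixed_real`), so
  `∫ μ^{η'}_Λ(A) dμ(η') = lim_L ⟨μ^·_Λ(A)⟩^η_{B(L)} = lim_L μ^η_{B(L)}(A) = μ(A)` by the consistency
  of the Ising kernels (`lintegral_isingMeasure_fixed_consistent`, Lemma 6.7, valid once
  `Λ ⊆ B(L)`); local events determine the measures
  (`measure_eq_of_forall_isLocalEvent_preimage_eq`).
* `isTranslationInvariantMeasure_of_spinCorr_eq` — a probability measure whose correlations are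
  a translation-invariant set function is translation invariant (correlations determine the
  measure, `measure_eq_of_forall_spinCorr_eq`; Friedli–Velenik Example 6.51);
  `plusCorr_map_shift` (every `h`, from `plusExpect_spinProduct_comp_shift`, FKG) and
  `minusCorr_map_shift` (spin flip).
* `exists_gibbsMeasure_of_tendsto_isingCorr_fixed_box` packages the above;
  `exists_minusMeasure_holds` and `exists_plusMeasure_holds` are the discharges.

## Mathlib

`Measure.bind` / `Measure.bind_apply`, `MeasureTheory.ofReal_integral_eq_lintegral_ofReal`,
`MeasurableEquiv.map_symm_map`, `integral_map`, `tendsto_finsetSum`, `Tendsto.limUnder_eq`.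
No Gibbs measures in Mathlib.

## References

* S. Friedli, Y. Velenik, *Statistical Mechanics of Lattice Systems* (CUP 2017), §3.4
  (Thm. 3.17, proof p. 107–108), §3.6.2 (Lemmas 3.19, 3.22), §3.7.1 (spin flip), §6.4.3
  (Thm. 6.26), §6.2 (Lemma 6.7), Example 6.51.
* H.-O. Georgii, *Gibbs Measures and Phase Transitions*, 2nd ed. (de Gruyter 2011), §4.3–4.4,
  §6.2.
-/

noncomputable section

open MeasureTheory Filter Topology Finset
open Literature.Probability.Percolation

namespace Literature.Probability.LatticeModels

variable {d : ℕ}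

/-! ### Box limits of the plus and minus correlations for every field -/

/-- **The plus correlations converge along boxes for every field** (Friedli–Velenik 2017,
Thm. 3.17 and its proof: `σ_A = ∑_{B⊆A} c_B n_B` (Lemma 3.19) and `⟨n_B⟩⁺_{B(L);β,h}` is
nonincreasing in `L` by FKG (Lemma 3.22)): for `β ≥ 0` and `h ∈ ℝ`,
`⟨σ_A⟩⁺_{B(L);β,h} → ⟨σ_A⟩⁺_{β,h} = plusCorr d β h A`, which is therefore a genuine limit.
(The tree's `hasBoxLimit_isingCorr_plus_holds` is the GKS route, for `h ≥ 0` only.)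
[cite: FriedliVelenik2017, Thm. 3.17] -/
theorem tendsto_isingCorr_plus_box {β : ℝ} (hβ : 0 ≤ β) (h : ℝ) (A : Finset (Site d)) :
    Tendsto (fun L : ℕ => isingCorr (zdGraph d) (box d L) β h .plus A) atTop
      (𝓝 (plusCorr d β h A)) := by
  classical
  have hfkg : ∀ β' : ℝ, ising_fkg (zdGraph d) (β := β') := fun _ => ising_fkg_holds (zdGraph d)
  set c : Finset (Site d) → ℝ := fun B => (-1 : ℝ) ^ #(A \ B) * 2 ^ #B with hc
  have hlin : ∀ L : ℕ, isingCorr (zdGraph d) (box d L) β h .plus A =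
      ∑ B ∈ A.powerset, c B * isingExpect (zdGraph d) (box d L) β h .plus (plusIndicator B) := by
    intro L
    rw [isingCorr, show spinProduct A = fun σ => ∑ B ∈ A.powerset, c B * plusIndicator B σ from
        funext fun σ => spinProduct_eq_sum_plusIndicator A σ,
      isingExpect_finset_sum' _ _ _ _ β A.powerset (fun B σ => c B * plusIndicator B σ)
        fun B => (measurable_plusIndicator B).const_mul _]
    exact sum_congr rfl fun B _ => isingExpect_const_mul' _ _ _ _ β (c B) (measurable_plusIndicator B)
  have ht : Tendsto (fun L : ℕ => isingCorr (zdGraph d) (box d L) β h .plus A) atTop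
      (𝓝 (∑ B ∈ A.powerset, c B * plusExpect d β h (plusIndicator B))) := by
    simp_rw [hlin]
    exact tendsto_finsetSum _ fun B _ =>
      (tendsto_isingExpect_plus_plusIndicator hfkg hβ h B).const_mul _
  have heq : plusCorr d β h A = ∑ B ∈ A.powerset, c B * plusExpect d β h (plusIndicator B) :=
    ht.limUnder_eq
  rw [heq]
  exact ht

/-- **The minus boundary condition is the spin flip of the plus boundary condition at the
opposite field**: `⟨σ_A⟩⁻_{Λ;β,h} = (-1)^{|A|} ⟨σ_A⟩⁺_{Λ;β,-h}` on any locally finite graph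
(Friedli–Velenik 2017, §3.7.1; the tree's `isingCorr_fixed_flip_holds` with `η ≡ +1`).
[cite: FriedliVelenik2017, §3.7.1] -/
theorem isingCorr_minus_eq_flip {V : Type*} (G : SimpleGraph V) [DecidableEq V] [G.LocallyFinite]
    (Λ : Finset V) (β h : ℝ) (A : Finset V) :
    isingCorr G Λ β h .minus A = (-1) ^ #A * isingCorr G Λ β (-h) .plus A := by
  have key := isingCorr_fixed_flip_holds G Λ β (-h) 1 A
  rw [neg_neg] at key
  exact key

/-- The minus box correlations converge to the flipped plus limit:
`⟨σ_A⟩⁻_{B(L);β,h} → (-1)^{|A|} ⟨σ_A⟩⁺_{β,-h}` for `β ≥ 0`, `h ∈ ℝ` (Friedli–Velenik 2017,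
Thm. 3.17 with §3.7.1). [cite: FriedliVelenik2017, Thm. 3.17 and §3.7.1] -/
theorem tendsto_isingCorr_minus_box_flip {β : ℝ} (hβ : 0 ≤ β) (h : ℝ) (A : Finset (Site d)) :
    Tendsto (fun L : ℕ => isingCorr (zdGraph d) (box d L) β h .minus A) atTop
      (𝓝 ((-1) ^ #A * plusCorr d β (-h) A)) := by
  simp_rw [isingCorr_minus_eq_flip]
  exact (tendsto_isingCorr_plus_box hβ (-h) A).const_mul _

/-- **`⟨σ_A⟩⁻_{β,h} = (-1)^{|A|} ⟨σ_A⟩⁺_{β,-h}`** for `β ≥ 0`, `h ∈ ℝ`: the minus state is the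
image of the plus state at field `-h` under the global spin flip (Friedli–Velenik 2017, §3.7.1
and Thm. 3.17). [cite: FriedliVelenik2017, Thm. 3.17 and §3.7.1] -/
theorem minusCorr_eq_plusCorr_neg {β : ℝ} (hβ : 0 ≤ β) (h : ℝ) (A : Finset (Site d)) :
    minusCorr d β h A = (-1) ^ #A * plusCorr d β (-h) A :=
  (tendsto_isingCorr_minus_box_flip hβ h A).limUnder_eq

/-- **The minus correlations converge along boxes for every field** (Friedli–Velenik 2017,
Thm. 3.17, `−` boundary condition): for `β ≥ 0` and `h ∈ ℝ`,
`⟨σ_A⟩⁻_{B(L);β,h} → ⟨σ_A⟩⁻_{β,h} = minusCorr d β h A`. [cite: FriedliVelenik2017, Thm. 3.17] -/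
theorem tendsto_isingCorr_minus_box {β : ℝ} (hβ : 0 ≤ β) (h : ℝ) (A : Finset (Site d)) :
    Tendsto (fun L : ℕ => isingCorr (zdGraph d) (box d L) β h .minus A) atTop
      (𝓝 (minusCorr d β h A)) := by
  rw [minusCorr_eq_plusCorr_neg hβ h A]
  exact tendsto_isingCorr_minus_box_flip hβ h A

/-! ### Local observables -/

/-- **Box expectations of local observables converge once all correlations do** (Friedli–Velenik
2017, proof of Thm. 3.17 via Lemma 3.19: a function of the spins in a finite window `D` is a
finite linear combination `∑_B c_B σ_B`, `B ⊆ D`). For any boundary condition `bc` whose box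
correlations `⟨σ_B⟩^{bc}_{B(L);β,h}` all converge, `⟨F⟩^{bc}_{B(L);β,h}` converges for every `F`
depending only on the spins in `D`. [cite: FriedliVelenik2017, Thm. 3.17 (proof) and Lemma 3.19] -/
theorem tendsto_isingExpect_box_of_dependsOn {β h : ℝ} (bc : BoundaryCondition (Site d))
    {c : Finset (Site d) → ℝ}
    (hcorr : ∀ B : Finset (Site d),
      Tendsto (fun L : ℕ => isingCorr (zdGraph d) (box d L) β h bc B) atTop (𝓝 (c B)))
    (D : Finset (Site d)) {F : SpinConfig (Site d) → ℝ} (hF : DependsOn F (↑D : Set (Site d))) :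
    ∃ a : ℝ, Tendsto (fun L : ℕ => isingExpect (zdGraph d) (box d L) β h bc F) atTop (𝓝 a) := by
  classical
  obtain ⟨coef, hc⟩ := exists_sum_spinProduct_of_dependsOn D hF
  have hFeq : F = fun σ => ∑ B : Finset ↥D, coef B *
      spinProduct (B.map (Function.Embedding.subtype (· ∈ D))) σ := funext hc
  refine ⟨∑ B : Finset ↥D, coef B * c (B.map (Function.Embedding.subtype (· ∈ D))), ?_⟩
  rw [hFeq]
  have hlin : ∀ L : ℕ, isingExpect (zdGraph d) (box d L) β h bc (fun σ => ∑ B : Finset ↥D, coef B *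
      spinProduct (B.map (Function.Embedding.subtype (· ∈ D))) σ) =
      ∑ B : Finset ↥D, coef B * isingCorr (zdGraph d) (box d L) β h bc
        (B.map (Function.Embedding.subtype (· ∈ D))) := by
    intro L
    rw [isingExpect_finset_sum' _ _ _ _ β _ _ fun B => (measurable_spinProduct _).const_mul (coef B)]
    refine Finset.sum_congr rfl fun B _ => ?_
    rw [isingExpect_const_mul' _ _ _ _ β (coef B) (measurable_spinProduct _)]
    rfl
  simp_rw [hlin]
  exact tendsto_finsetSum _ fun B _ => (hcorr _).const_mul _

/-! ### The limit measure of a sequence with convergent local expectations -/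

/-- **The thermodynamic limit as a probability measure** (Friedli–Velenik 2017, Thm. 6.5 /
Def. 6.4 with Thm. 3.17: a state obtained as a limit of finite-volume Gibbs distributions on local
functions is a probability measure on `{±1}^{ℤ^d}`, the weak limit of the distributions). If
`ν_L` are probability measures on `SpinConfig (Site d)` such that `∫ F dν_L` converges for every
`F` depending on finitely many spins, then there is a probability measure `μ` with
`∫ F dν_L → ∫ F dμ` for all such `F`. Construction: the images of `ν_L` on `Set (Site d)`
(`spinConfigEquivSet`) converge on local events, whose indicators are local observables;
Kolmogorov's extension theorem (`exists_measure_tendsto_of_isLocalEvent`) gives the limit; local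
expectations are finite sums over the spin patterns of a window. [cite: FriedliVelenik2017, Thm. 6.5 and Thm. 3.17] -/
theorem exists_measure_tendsto_integral_of_dependsOn (ν : ℕ → Measure (SpinConfig (Site d)))
    [∀ L, IsProbabilityMeasure (ν L)]
    (hlim : ∀ (D : Finset (Site d)) (F : SpinConfig (Site d) → ℝ), DependsOn F (↑D : Set (Site d)) →
      ∃ a : ℝ, Tendsto (fun L => ∫ σ, F σ ∂(ν L)) atTop (𝓝 a)) :
    ∃ μ : Measure (SpinConfig (Site d)), IsProbabilityMeasure μ ∧
      ∀ (D : Finset (Site d)) (F : SpinConfig (Site d) → ℝ), DependsOn F (↑D : Set (Site d)) →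
        Tendsto (fun L => ∫ σ, F σ ∂(ν L)) atTop (𝓝 (∫ σ, F σ ∂μ)) := by
  classical
  set e := spinConfigEquivSet (Site d) with he
  set μs : ℕ → Measure (Set (Site d)) := fun L => (ν L).map e with hμs
  haveI : ∀ L, IsProbabilityMeasure (μs L) := fun L =>
    Measure.isProbabilityMeasure_map e.measurable.aemeasurable
  -- expansion of the integral of a local observable along the spin patterns of its window
  have hexp : ∀ (D : Finset (Site d)) (F : SpinConfig (Site d) → ℝ), DependsOn F (↑D : Set (Site d)) →
      ∀ (ρ : Measure (SpinConfig (Site d))) [IsProbabilityMeasure ρ],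
        ∫ σ, F σ ∂ρ = ∑ η : ↥D → ℤˣ, F (fun x => if hx : x ∈ D then η ⟨x, hx⟩ else 1) *
          ρ.real {σ : SpinConfig (Site d) | (fun x : ↥D => σ x) = η} := by
    intro D F hF ρ _
    have hFeq : (fun σ => F σ) = fun σ => ∑ η : ↥D → ℤˣ,
        F (fun x => if hx : x ∈ D then η ⟨x, hx⟩ else 1) *
          {τ : SpinConfig (Site d) | (fun x : ↥D => τ x) = η}.indicator (1 : SpinConfig (Site d) → ℝ) σ :=
      funext (dependsOn_eq_sum_mul_indicator D hF)
    rw [hFeq, integral_finsetSum]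
    · refine Finset.sum_congr rfl fun η _ => ?_
      rw [integral_const_mul, integral_indicator_one (measurableSet_pattern D η)]
    · intro η _
      exact (show Integrable ({τ : SpinConfig (Site d) | (fun x : ↥D => τ x) = η}.indicator
          (1 : SpinConfig (Site d) → ℝ)) ρ from
        (integrable_const (1 : ℝ)).indicator (measurableSet_pattern D η)).const_mul _
  -- convergence on local events of `Set (Site d)`
  have hconv : ∀ A : Set (Set (Site d)), IsLocalEvent A →
      ∃ a : ENNReal, Tendsto (fun L => μs L A) atTop (𝓝 a) := by
    intro A hA
    obtain ⟨J, hJ⟩ := hA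
    have hAm : MeasurableSet A := measurableSet_of_isLocalEvent_holds ⟨J, hJ⟩
    set χ : SpinConfig (Site d) → ℝ := (e ⁻¹' A).indicator 1 with hχ
    have hχdep : DependsOn χ (↑J : Set (Site d)) := dependsOn_indicator_preimage_of_determinedBy hJ
    have hval : ∀ L, μs L A = ENNReal.ofReal (∫ σ, χ σ ∂(ν L)) := by
      intro L
      change ((ν L).map e) A = _
      rw [Measure.map_apply e.measurable hAm, hχ, integral_indicator_one (e.measurable hAm),
        ofReal_measureReal]
    obtain ⟨a, ha⟩ := hlim J χ hχdep
    refine ⟨ENNReal.ofReal a, ?_⟩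
    simp_rw [hval]
    exact ENNReal.tendsto_ofReal ha
  obtain ⟨μ', hμ'P, hμ'⟩ := exists_measure_tendsto_of_isLocalEvent μs hconv
  haveI := hμ'P
  haveI hμP : IsProbabilityMeasure (μ'.map e.symm) :=
    Measure.isProbabilityMeasure_map e.symm.measurable.aemeasurable
  refine ⟨μ'.map e.symm, hμP, ?_⟩
  intro D F hF
  -- probabilities of the spin patterns of the window `D` converge
  have hpat : ∀ η : ↥D → ℤˣ,
      Tendsto (fun L => (ν L).real {σ : SpinConfig (Site d) | (fun x : ↥D => σ x) = η}) atTop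
        (𝓝 ((μ'.map e.symm).real {σ : SpinConfig (Site d) | (fun x : ↥D => σ x) = η})) := by
    intro η
    set P : Set (Set (Site d)) := {ω | ∀ x : ↥D, ((x : Site d) ∈ ω ↔ η x = 1)} with hP
    have hPloc : IsLocalEvent P := isLocalEvent_patternSet D η
    have hPm : MeasurableSet P := measurableSet_of_isLocalEvent_holds hPloc
    have h1 : ∀ L, (ν L) {σ : SpinConfig (Site d) | (fun x : ↥D => σ x) = η} = μs L P := by
      intro L
      rw [pattern_eq_preimage]
      change (ν L) (e ⁻¹' P) = ((ν L).map e) P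
      rw [Measure.map_apply e.measurable hPm]
    have h2 : (μ'.map e.symm) {σ : SpinConfig (Site d) | (fun x : ↥D => σ x) = η} = μ' P := by
      rw [pattern_eq_preimage]
      change (μ'.map e.symm) (e ⁻¹' P) = μ' P
      rw [Measure.map_apply e.symm.measurable (e.measurable hPm), MeasurableEquiv.symm_preimage_preimage]
    simp_rw [measureReal_def, h1, h2]
    exact (ENNReal.tendsto_toReal (measure_ne_top μ' P)).comp (hμ' P hPloc)
  rw [hexp D F hF (μ'.map e.symm)]
  have hL : ∀ L, ∫ σ, F σ ∂(ν L) =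
      ∑ η : ↥D → ℤˣ, F (fun x => if hx : x ∈ D then η ⟨x, hx⟩ else 1) *
        (ν L).real {σ : SpinConfig (Site d) | (fun x : ↥D => σ x) = η} := fun L =>
    hexp D F hF (ν L)
  simp_rw [hL]
  exact tendsto_finsetSum _ fun η _ => (hpat η).const_mul _

/-! ### The DLR equations for limits of boxes with a fixed boundary condition -/

/-- **Thermodynamic limits of boxes with a fixed boundary condition are Gibbs measures**
(Friedli–Velenik 2017, Thm. 6.26: the limit of `μ_n = π_{B(n)}(· | ω)` lies in `𝒢(π)`, via the
consistency `μ_n π_Λ = μ_n` once `B(n) ⊃ Λ`, eq. (6.34), and the locality of `π_Λ f`). If the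
expectations of every local observable in the boxes `B(L)` with boundary condition `η` converge to
its `μ`-integral, then `μ` satisfies the DLR equations for the Ising specification of `ℤ^d`: for a
local event `A` the boundary-condition dependence `η' ↦ μ^{η'}_Λ(A)` is a local observable, so
`∫ μ^{η'}_Λ(A) dμ(η') = lim ⟨μ^·_Λ(A)⟩^η_{B(L)} = lim μ^η_{B(L)}(A) = μ(A)` by the consistency of the
Ising kernels (`lintegral_isingMeasure_fixed_consistent`, Lemma 6.7, valid once `Λ ⊆ B(L)`);
local events determine the measures. No sign condition on `β, h`. [cite: FriedliVelenik2017, Thm. 6.26 and Lemma 6.7] -/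
theorem isGibbsMeasure_of_tendsto_isingExpect_fixed_box {β h : ℝ} (η : SpinConfig (Site d))
    (μ : Measure (SpinConfig (Site d))) [IsProbabilityMeasure μ]
    (hμ : ∀ (D : Finset (Site d)) (F : SpinConfig (Site d) → ℝ), DependsOn F (↑D : Set (Site d)) →
      Tendsto (fun L : ℕ => isingExpect (zdGraph d) (box d L) β h (.fixed η) F) atTop
        (𝓝 (∫ σ, F σ ∂μ))) :
    IsGibbsMeasure (isingSpecification (zdGraph d) β h) μ := by
  classical
  refine ⟨inferInstance, fun Λ A hA => ?_⟩
  set e := spinConfigEquivSet (Site d) with he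
  set κ : SpinConfig (Site d) → Measure (SpinConfig (Site d)) :=
    fun ζ => isingMeasure (zdGraph d) Λ β h (.fixed ζ) with hκ
  have hκm : Measurable κ := measurable_isingMeasure_fixed_zd Λ β h
  haveI : ∀ ζ, IsProbabilityMeasure (κ ζ) := fun ζ => by rw [hκ]; infer_instance
  -- the left-hand side as the measure `μ.bind κ`
  set ν₁ : Measure (SpinConfig (Site d)) := μ.bind κ with hν₁
  have hν₁_apply : ∀ {S : Set (SpinConfig (Site d))}, MeasurableSet S →
      ν₁ S = ∫⁻ ζ, κ ζ S ∂μ := fun hS => Measure.bind_apply hS hκm.aemeasurable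
  haveI : IsProbabilityMeasure ν₁ := ⟨by
    rw [hν₁_apply MeasurableSet.univ]
    simp⟩
  -- it suffices to compare `ν₁` and `μ` on preimages of local events
  suffices hmain : ν₁ = μ by
    have := hν₁_apply hA
    rw [hmain] at this
    simpa [hκ] using this.symm
  refine measure_eq_of_forall_isLocalEvent_preimage_eq ν₁ μ fun A' hA' => ?_
  obtain ⟨J, hJ⟩ := hA'
  have hA'm : MeasurableSet A' := measurableSet_of_isLocalEvent_holds ⟨J, hJ⟩
  set S : Set (SpinConfig (Site d)) := e ⁻¹' A' with hS
  have hSm : MeasurableSet S := e.measurable hA'm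
  have hSdep : ∀ σ τ : SpinConfig (Site d), (∀ x ∈ J, σ x = τ x) → (σ ∈ S ↔ τ ∈ S) := by
    intro σ τ hst
    exact (determinedBy_iff A' _).1 hJ _ _ (spinConfigEquivSet_inter_eq fun x hx => hst x hx)
  -- the boundary-condition dependence `g ζ = μ^ζ_Λ(S)` is a local observable
  set g : SpinConfig (Site d) → ℝ := fun ζ => (κ ζ).real S with hg
  have hgdep : DependsOn g (↑(outerBoundary (zdGraph d) Λ ∪ J) : Set (Site d)) :=
    dependsOn_isingMeasure_fixed_real Λ J β h hSm hSdep
  have hgm : Measurable g := DependsOn.measurable_of_finset _ hgdep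
  have hg0 : ∀ ζ, 0 ≤ g ζ := fun ζ => measureReal_nonneg
  have hg1 : ∀ ζ, g ζ ≤ 1 := fun ζ => measureReal_le_one
  have hgi : ∀ (ρ : Measure (SpinConfig (Site d))) [IsFiniteMeasure ρ], Integrable g ρ := fun ρ _ =>
    Integrable.of_bound hgm.aestronglyMeasurable 1 (Eventually.of_forall fun ζ => by
      rw [Real.norm_eq_abs, abs_of_nonneg (hg0 ζ)]; exact hg1 ζ)
  have hκS : ∀ ζ, κ ζ S = ENNReal.ofReal (g ζ) := fun ζ => (ofReal_measureReal).symm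
  -- `ν₁ S = ofReal (∫ g dμ)`
  have h1 : ν₁ S = ENNReal.ofReal (∫ ζ, g ζ ∂μ) := by
    rw [hν₁_apply hSm]
    simp_rw [hκS]
    exact (ofReal_integral_eq_lintegral_ofReal (hgi μ) (Eventually.of_forall hg0)).symm
  -- the indicator of `S` is a local observable too
  set χ : SpinConfig (Site d) → ℝ := S.indicator 1 with hχ
  have hχdep : DependsOn χ (↑J : Set (Site d)) := dependsOn_indicator_preimage_of_determinedBy hJ
  -- in a box containing `Λ`, `⟨g⟩^η_{B(L)} = μ^η_{B(L)}(S) = ⟨χ⟩^η_{B(L)}` (consistency of the kernels)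
  obtain ⟨L₀, hL₀⟩ := exists_forall_subset_box d Λ
  have hbox : ∀ L, L₀ ≤ L →
      isingExpect (zdGraph d) (box d L) β h (.fixed η) g =
        isingExpect (zdGraph d) (box d L) β h (.fixed η) χ := by
    intro L hL
    have key := lintegral_isingMeasure_fixed_consistent (zdGraph d) (hL₀ L hL) β h η hSm
    -- both sides as real numbers
    have hl : ∫⁻ σ, isingMeasure (zdGraph d) Λ β h (.fixed σ) S
        ∂(isingMeasure (zdGraph d) (box d L) β h (.fixed η)) =
        ENNReal.ofReal (isingExpect (zdGraph d) (box d L) β h (.fixed η) g) := by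
      change ∫⁻ σ, κ σ S ∂_ = _
      simp_rw [hκS]
      rw [isingExpect]
      exact (ofReal_integral_eq_lintegral_ofReal (hgi _) (Eventually.of_forall hg0)).symm
    have hr : isingMeasure (zdGraph d) (box d L) β h (.fixed η) S =
        ENNReal.ofReal (isingExpect (zdGraph d) (box d L) β h (.fixed η) χ) := by
      rw [isingExpect, hχ, integral_indicator_one hSm, ofReal_measureReal]
    rw [hl, hr] at key
    have hgE : 0 ≤ isingExpect (zdGraph d) (box d L) β h (.fixed η) g := integral_nonneg hg0
    have hχE : 0 ≤ isingExpect (zdGraph d) (box d L) β h (.fixed η) χ :=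
      integral_nonneg fun σ => Set.indicator_nonneg (fun _ _ => zero_le_one) σ
    exact (ENNReal.ofReal_eq_ofReal_iff hgE hχE).1 key
  -- pass to the limit
  have hlimg := hμ _ g hgdep
  have hlimχ := hμ J χ hχdep
  have heq : ∫ ζ, g ζ ∂μ = ∫ σ, χ σ ∂μ := by
    refine tendsto_nhds_unique hlimg (hlimχ.congr' ?_)
    filter_upwards [eventually_ge_atTop L₀] with L hL
    exact (hbox L hL).symm
  rw [h1, heq, hχ, integral_indicator_one hSm, ofReal_measureReal]

/-! ### Translation invariance -/

/-- **A probability measure whose correlations form a translation-invariant set function is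
translation invariant** (Friedli–Velenik 2017, Example 6.51: `θ_j μ` and `μ` coincide on
cylinders, which generate `𝓕`; here: the translate has correlations
`∫ σ_B ∘ θ_v dμ = c(B - v) = c(B)`, and the correlations determine the measure,
`measure_eq_of_forall_spinCorr_eq`). [cite: FriedliVelenik2017, Example 6.51] -/
theorem isTranslationInvariantMeasure_of_spinCorr_eq {c : Finset (Site d) → ℝ}
    (hc : ∀ (B : Finset (Site d)) (v : Site d), c (B.map (Site.shift v).toEmbedding) = c B)
    (μ : Measure (SpinConfig (Site d))) [IsProbabilityMeasure μ]
    (hcorr : ∀ A : Finset (Site d), spinCorr μ A = c A) :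
    IsTranslationInvariantMeasure μ := by
  classical
  intro v
  haveI : IsProbabilityMeasure (μ.map (configShift v)) :=
    Measure.isProbabilityMeasure_map (configShift (S := ℤˣ) v).measurable.aemeasurable
  refine measure_eq_of_forall_spinCorr_eq _ _ fun B => ?_
  rw [spinCorr, integral_map (configShift (S := ℤˣ) v).measurable.aemeasurable
    (measurable_spinProduct B).aestronglyMeasurable]
  simp_rw [spinProduct_configShift]
  change spinCorr μ (B.map (Site.shift (-v)).toEmbedding) = spinCorr μ B
  rw [hcorr, hcorr, hc]

/-- **Translation invariance of the plus correlations for every field**: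
`⟨σ_{A+v}⟩⁺_{β,h} = ⟨σ_A⟩⁺_{β,h}` for `β ≥ 0`, `h ∈ ℝ` (Friedli–Velenik 2017, Thm. 3.17; from
`plusExpect_spinProduct_comp_shift`, FKG). (The tree's `plusCorr_shift` is the GKS route, for
`h ≥ 0` only.) [cite: FriedliVelenik2017, Thm. 3.17] -/
theorem plusCorr_map_shift {β : ℝ} (hβ : 0 ≤ β) (h : ℝ) (A : Finset (Site d)) (v : Site d) :
    plusCorr d β h (A.map (Site.shift v).toEmbedding) = plusCorr d β h A := by
  have hfun : spinProduct (A.map (Site.shift v).toEmbedding) = spinProduct A ∘ configShift (-v) := by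
    funext σ
    rw [Function.comp_apply, spinProduct_configShift, neg_neg]
  change plusExpect d β h (spinProduct (A.map (Site.shift v).toEmbedding)) =
    plusExpect d β h (spinProduct A)
  rw [hfun]
  exact plusExpect_spinProduct_comp_shift (fun _ => ising_fkg_holds (zdGraph d)) hβ h A (-v)

/-- **Translation invariance of the minus correlations**: `⟨σ_{A+v}⟩⁻_{β,h} = ⟨σ_A⟩⁻_{β,h}` for
`β ≥ 0`, `h ∈ ℝ` (Friedli–Velenik 2017, Thm. 3.17; by the spin flip from the plus state at field
`-h`). [cite: FriedliVelenik2017, Thm. 3.17] -/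
theorem minusCorr_map_shift {β : ℝ} (hβ : 0 ≤ β) (h : ℝ) (A : Finset (Site d)) (v : Site d) :
    minusCorr d β h (A.map (Site.shift v).toEmbedding) = minusCorr d β h A := by
  rw [minusCorr_eq_plusCorr_neg hβ h, minusCorr_eq_plusCorr_neg hβ h, Finset.card_map,
    plusCorr_map_shift hβ (-h) A v]

/-! ### Gibbs measures from boxes with a fixed boundary condition; the discharges -/

/-- **Infinite-volume Gibbs measures prepared with a fixed boundary condition along boxes**
(Friedli–Velenik 2017, Thm. 3.17 with Thm. 6.26 and Example 6.51). If the box correlations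
`⟨σ_A⟩^η_{B(L);β,h}` converge to a translation-invariant set function `c`, then there is a
probability measure on `{−1,+1}^{ℤ^d}` satisfying the DLR equations for the Ising specification,
translation invariant, with correlations `c`: the limit measure of
`exists_measure_tendsto_integral_of_dependsOn` (local expectations converge by
`tendsto_isingExpect_box_of_dependsOn`), Gibbs by `isGibbsMeasure_of_tendsto_isingExpect_fixed_box`
and translation invariant by `isTranslationInvariantMeasure_of_spinCorr_eq`. [cite: FriedliVelenik2017, Thm. 3.17 and Thm. 6.26] -/
theorem exists_gibbsMeasure_of_tendsto_isingCorr_fixed_box {β h : ℝ} (η : SpinConfig (Site d))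
    {c : Finset (Site d) → ℝ}
    (hcorr : ∀ A : Finset (Site d),
      Tendsto (fun L : ℕ => isingCorr (zdGraph d) (box d L) β h (.fixed η) A) atTop (𝓝 (c A)))
    (hc : ∀ (B : Finset (Site d)) (v : Site d), c (B.map (Site.shift v).toEmbedding) = c B) :
    ∃ μ ∈ isingGibbsMeasures d β h, IsTranslationInvariantMeasure μ ∧
      ∀ A : Finset (Site d), spinCorr μ A = c A := by
  obtain ⟨μ, hμP, hμ⟩ := exists_measure_tendsto_integral_of_dependsOn
    (fun L => isingMeasure (zdGraph d) (box d L) β h (.fixed η))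
    (fun D F hF => tendsto_isingExpect_box_of_dependsOn (.fixed η) hcorr D hF)
  have hcorrμ : ∀ A : Finset (Site d), spinCorr μ A = c A := by
    intro A
    have hdep : DependsOn (spinProduct A : SpinConfig (Site d) → ℝ) (↑A : Set (Site d)) :=
      fun σ τ hst => Finset.prod_congr rfl fun x hx => by
        simp only [spinAt, hst x (Finset.mem_coe.2 hx)]
    exact tendsto_nhds_unique (hμ A (spinProduct A) hdep) (hcorr A)
  refine ⟨μ, ?_, isTranslationInvariantMeasure_of_spinCorr_eq hc μ hcorrμ, hcorrμ⟩
  rw [mem_isingGibbsMeasures_iff]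
  exact isGibbsMeasure_of_tendsto_isingExpect_fixed_box η μ hμ

variable {β h : ℝ} in
/-- **Discharge of `exists_minusMeasure`** (crit-ising.S05, `GibbsStates.lean`; Friedli–Velenik
2017, Thm. 3.17 (existence along boxes and translation invariance of `⟨·⟩⁻_{β,h}`, `β ≥ 0`,
`h ∈ ℝ`), Thm. 6.26 (thermodynamic limits of finite-volume Gibbs distributions lie in `𝒢(β,h)`),
Example 6.51): for `β ≥ 0` and every `h` there is a probability measure on `{−1,+1}^{ℤ^d}`
satisfying the DLR equations for the Ising specification, translation invariant, with
correlations `⟨σ_A⟩⁻_{β,h} = minusCorr d β h A` — the limit of the minus boxes, whose correlations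
converge by `tendsto_isingCorr_minus_box` (spin flip of the FKG-monotone plus boxes at field
`-h`). [cite: FriedliVelenik2017, Thm. 3.17 and Thm. 6.26] -/
theorem exists_minusMeasure_holds : exists_minusMeasure d (β := β) h :=
  fun hβ => exists_gibbsMeasure_of_tendsto_isingCorr_fixed_box (-1)
    (tendsto_isingCorr_minus_box hβ h) (fun B v => minusCorr_map_shift hβ h B v)

variable {β h : ℝ} in
/-- **Discharge of `exists_plusMeasure`** (crit-ising.S05, `GibbsStates.lean`; Friedli–Velenik
2017, Thm. 3.17, Thm. 6.26 / Lemma 6.7, Example 6.51): for `β ≥ 0` and every `h` there is a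
probability measure on `{−1,+1}^{ℤ^d}` satisfying the DLR equations for the Ising specification,
translation invariant, with correlations `⟨σ_A⟩⁺_{β,h} = plusCorr d β h A` — the limit of the plus
boxes, whose correlations converge for every `h` by FKG (`tendsto_isingCorr_plus_box`). [cite: FriedliVelenik2017, Thm. 3.17 and Thm. 6.26] -/
theorem exists_plusMeasure_holds : exists_plusMeasure d (β := β) h :=
  fun hβ => exists_gibbsMeasure_of_tendsto_isingCorr_fixed_box 1
    (tendsto_isingCorr_plus_box hβ h) (fun B v => plusCorr_map_shift hβ h B v)

end Literature.Probability.LatticeModels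

end
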